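import Summits.CriticalPhenomena.PercolationContinuityZ3.Theorems.PercNearOneGluingNoHeavyLowerTailSunflowerMultiPetalKempeNeighbourhoodContraction
import Mathlib.Data.Sym.Sym2.Order
import HarnessLib
import HarnessLib.Audit

/-!
# `NoHeavyLowerTail` (crux stmt-CriticalPhenomena-4575), Lemma B for graph clutters: the MARKED-MULTIGRAPH LAYER (definitions) for the
# kernel-checked version of the neighbourhood-contraction induction (memo FINDING-g47 §6)

Support/definitions file (seat `prim-l12-p2` gen 47; `--supports stmt-CriticalPhenomena-4575`).  No `sorry`; nothing is asserted about the crux.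
Memo: run/shared/lean/prim/prim-l12/prim-l12-p2/FINDING-g47-NEIGHBOURHOOD-CONTRACTION-STEP.md §4, §6.

WHY.  The step law of the memo (THEOREM L1, proved there for all degrees),
`T(K;u,v) ≥ T(K−y;u,v) + T((K−y)/(N(y)∖{v} → u);u,v)`, closes the induction for the two-terminal inequality and hence Lemma B — but the contraction
`(K−y)/(N(y) → u)` turns edges inside `N(y) ∪ {u}` into MARKS on `u` and parallel edges into MULTIPLICITIES, so the induction runs through marked
multigraphs even when `K` is simple.  The tree's two-terminal layer (`Tfun`, `TwoTerminalC`, p416807) is `SimpleGraph`-valued; this file supplies the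
marked-multigraph objects, on the SAME vertex type throughout (isolated unmarked vertices only multiply `T` by `3`), and the bridge to `Tfun`:
* `MGraph V` (symmetric loopless multiplicities `mul : V → V → ℕ`, marks `mark : V → ℕ`; capping happens in the type), `cntM`, `ctypeM`, `TfunM`, `QcolM`;
* `isolate y` (delete the edges and marks at `y`), `peelContract y S u` (`K − y` with `S` contracted into the terminal `u`, realised on `V`);
* `ofSimple G` and the bridge `cntM_ofSimple`, `ctypeM_ofSimple`, **`TfunM_ofSimple : TfunM (ofSimple G) u v = Tfun G u v`**.
The targets for the successor files (memo §6): the row decomposition and `Φ_u`-pairing for `TfunM`, the step law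
`3^|S|·TfunM (K.isolate y) u v + TfunM (K.peelContract y S u) u v ≤ 3^(|S|+1)·TfunM K u v`, and the induction `0 ≤ TfunM`, `0 ≤ QcolM`.
-/

namespace Summit.CriticalPhenomena.PercolationContinuityZ3.Theorems.SunflowerPartition.Kempe

open Finset

/-- A MARKED MULTIGRAPH on `V`: symmetric edge multiplicities (no loops) and vertex marks. [this work] -/
structure MGraph (V : Type*) where
  /-- edge multiplicity -/
  mul : V → V → ℕ
  /-- marks (singleton members) -/
  mark : V → ℕ
  /-- multiplicities are symmetric -/
  symm : ∀ x y, mul x y = mul y x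
  /-- no loops (loops are marks) -/
  loopless : ∀ x, mul x x = 0

namespace MGraph

variable {V : Type*} [Fintype V] [LinearOrder V] (K : MGraph V)

/-- Number of monochromatic members of colour `c` (edges with multiplicity over ordered pairs `x < y`, plus marks). [this work] -/
def cntM (σ : V → Fin 3) (c : Fin 3) : ℕ :=
  (∑ x, ∑ y, if x < y ∧ σ x = c ∧ σ y = c then K.mul x y else 0) + ∑ x, if σ x = c then K.mark x else 0

/-- Capped type of a colouring. [this work] -/
def ctypeM (σ : V → Fin 3) : CType := (cap3 (K.cntM σ 0), cap3 (K.cntM σ 1), cap3 (K.cntM σ 2))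

/-- The two-terminal functional `T(K;u,v)/6 = Σ_{σ u = 0, σ v = 1} fC (type σ)`. [this work] -/
def TfunM (u v : V) : ℤ := ∑ σ ∈ univ.filter (fun σ : V → Fin 3 => σ u = 0 ∧ σ v = 1), fC (K.ctypeM σ)

/-- The Lemma-B functional `Q(K) = Σ_σ lbW (type σ)`. [this work] -/
def QcolM : ℤ := ∑ σ : V → Fin 3, lbW (K.ctypeM σ)

/-- Restriction to a vertex subset (vertex deletion = restriction to the complement). [this work] -/
def restrict (s : Set V) [DecidablePred (· ∈ s)] : MGraph s where
  mul x y := K.mul x.1 y.1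
  mark x := K.mark x.1
  symm x y := K.symm x.1 y.1
  loopless x := K.loopless x.1

/-- The marked multigraph of a simple graph. [this work] -/
def ofSimple (G : SimpleGraph V) [DecidableRel G.Adj] : MGraph V where
  mul x y := if G.Adj x y then 1 else 0
  mark _ := 0
  symm x y := by simp [G.adj_comm]
  loopless x := by simp

/-- `K` with the vertex `y` made isolated and unmarked. [this work] -/
def isolate (y : V) : MGraph V where
  mul a b := if a = y ∨ b = y then 0 else K.mul a b
  mark a := if a = y then 0 else K.mark a
  symm a b := by by_cases ha : a = y <;> by_cases hb : b = y <;> simp [ha, hb, K.symm]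
  loopless a := by by_cases ha : a = y <;> simp [ha, K.loopless]

/-- `K − y` with the finite set `S` (not containing `u`, `v`, `y`) contracted INTO `u`, realised on the same vertex type: `y` and every `s ∈ S` become
isolated unmarked vertices; `u` absorbs the marks of `S`, the edges inside `S ∪ {u}` (as marks) and the edges `S–w`. [this work] -/
def peelContract (y : V) (S : Finset V) (u : V) : MGraph V where
  mul a b :=
    if a = y ∨ b = y ∨ a ∈ S ∨ b ∈ S then 0
    else if a = u ∧ b ≠ u then K.mul u b + ∑ s ∈ S, K.mul s b
    else if b = u ∧ a ≠ u then K.mul a u + ∑ s ∈ S, K.mul a s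
    else K.mul a b
  mark a :=
    if a = y ∨ a ∈ S then 0
    else if a = u then K.mark u + (∑ s ∈ S, K.mark s) + (∑ s ∈ S, K.mul s u) + ∑ s ∈ S, ∑ s' ∈ S, if s < s' then K.mul s s' else 0
    else K.mark a
  symm a b := by
    by_cases h1 : a = y ∨ b = y ∨ a ∈ S ∨ b ∈ S
    · have h2 : b = y ∨ a = y ∨ b ∈ S ∨ a ∈ S := by tauto
      simp only [if_pos h1, if_pos h2]
    · have h2 : ¬(b = y ∨ a = y ∨ b ∈ S ∨ a ∈ S) := by tauto
      simp only [if_neg h1, if_neg h2]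
      by_cases ha : a = u <;> by_cases hb : b = u
      · subst ha; subst hb; simp
      · simp [ha, hb, K.symm]
      · simp [ha, hb, K.symm]
      · simp [ha, hb, K.symm]
  loopless a := by
    by_cases h1 : a = y ∨ a = y ∨ a ∈ S ∨ a ∈ S
    · simp only [if_pos h1]
    · simp only [if_neg h1]; simp [K.loopless]

/-! ## The bridge to the simple-graph layer -/

section Bridge

variable (G : SimpleGraph V) [DecidableRel G.Adj]

omit [Fintype V] in
/-- A pair of a simple graph's edge set, read through `inf/sup`, is an ordered adjacent pair. [this work] -/
theorem mk_inf_sup_eq (e : Sym2 V) : s(e.inf, e.sup) = e := by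
  induction e using Sym2.ind with
  | _ a b =>
    rw [Sym2.inf_mk, Sym2.sup_mk]
    rcases le_total a b with h | h
    · rw [min_eq_left h, max_eq_right h]
    · rw [min_eq_right h, max_eq_left h, Sym2.eq_swap]

/-- The monochromatic-edge count of the simple graph equals the ordered-pair count of `ofSimple G`. [this work] -/
theorem cntM_ofSimple (σ : V → Fin 3) (c : Fin 3) : (ofSimple G).cntM σ c = cnt G σ c := by
  unfold cntM cnt
  have hmark : (∑ x, if σ x = c then (ofSimple G).mark x else 0) = 0 :=
    sum_eq_zero fun x _ => by simp [ofSimple]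
  rw [hmark, add_zero]
  have hsum : (∑ x, ∑ y, if x < y ∧ σ x = c ∧ σ y = c then (ofSimple G).mul x y else 0)
      = ∑ p ∈ (univ : Finset (V × V)), (if p.1 < p.2 ∧ σ p.1 = c ∧ σ p.2 = c ∧ G.Adj p.1 p.2 then 1 else 0) := by
    rw [← univ_product_univ, sum_product]
    refine sum_congr rfl fun x _ => sum_congr rfl fun y _ => ?_
    by_cases h : x < y ∧ σ x = c ∧ σ y = c
    · by_cases ha : G.Adj x y
      · simp [ofSimple, h, ha]
      · simp [ofSimple, h, ha]
    · have h' : ¬(x < y ∧ σ x = c ∧ σ y = c ∧ G.Adj x y) := fun hh => h ⟨hh.1, hh.2.1, hh.2.2.1⟩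
      simp [h, h']
  rw [hsum, sum_boole, Nat.cast_id]
  refine card_nbij' (fun p => s(p.1, p.2)) (fun e => (e.inf, e.sup)) (fun p hp => ?_) (fun e he => ?_) (fun p hp => ?_) (fun e _ => ?_)
  · obtain ⟨hlt, h1, h2, hadj⟩ := (mem_filter.1 hp).2
    exact (mk_mem_monoCol_iff G σ c p.1 p.2).2 ⟨hadj, h1, h2⟩
  · have he' := he
    rw [← mk_inf_sup_eq e] at he'
    obtain ⟨hadj, h1, h2⟩ := (mk_mem_monoCol_iff G σ c e.inf e.sup).1 he'
    refine mem_filter.2 ⟨mem_univ _, lt_of_le_of_ne (Sym2.inf_le_sup e) hadj.ne, h1, h2, hadj⟩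
  · obtain ⟨hlt, -, -, -⟩ := (mem_filter.1 hp).2
    change (s(p.1, p.2).inf, s(p.1, p.2).sup) = p
    rw [Sym2.inf_mk, Sym2.sup_mk, min_eq_left hlt.le, max_eq_right hlt.le]
  · exact mk_inf_sup_eq e

/-- The capped type of `ofSimple G` is the simple-graph type. [this work] -/
theorem ctypeM_ofSimple (σ : V → Fin 3) : (ofSimple G).ctypeM σ = ctype G σ := by
  unfold ctypeM ctype
  rw [cntM_ofSimple, cntM_ofSimple, cntM_ofSimple]

/-- **`TfunM (ofSimple G) u v = Tfun G u v`**: the marked-multigraph functional extends the simple-graph two-terminal functional. [this work] -/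
theorem TfunM_ofSimple (u v : V) : (ofSimple G).TfunM u v = Tfun G u v := by
  unfold TfunM
  rw [Tfun_eq_sum]
  refine sum_congr ?_ fun σ _ => by rw [ctypeM_ofSimple]
  ext σ
  simp only [mem_filter, mem_univ, true_and]

end Bridge

end MGraph

end Summit.CriticalPhenomena.PercolationContinuityZ3.Theorems.SunflowerPartition.Kempe
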